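import Summits.BirchSwinnertonDyer.BirchSwinnertonDyer.Theorems.PrintCf2RubinValueTwoGoodTwistDictSignAvatar
import Summits.BirchSwinnertonDyer.BirchSwinnertonDyer.Theorems.PrintCf2SplitBadTwoHPrimeCyclotomic
import Summits.BirchSwinnertonDyer.BirchSwinnertonDyer.Theorems.PrintCf2SplitBadTwoGeneratorPairSpan
import Summits.BirchSwinnertonDyer.BirchSwinnertonDyer.Theorems.EisensteinPrimesTwoVariableOmegaBranchCharacters
import Summits.BirchSwinnertonDyer.Rank1Residual.X11b.Three.LambdaSupplyTransport
import Literature.NumberTheory.GaloisRepresentations.WeakAbelianDirectSummandCyclotomicProofs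
import Literature.NumberTheory.EllipticCurves.IwasawaCyclotomicProofs
import HarnessLib

/-!
# Route C `PrintCf2RubinValueTwo`, crux `GoodTwistDictionaryAtTwo` (stmt-BirchSwinnertonDyer-23295), PART 2 / F3:
# SIGNS ON `Υ = Gal(K̄/K̃_∞)` — `ℤ₂ˣ`-valued characters are `±1` there, `Υ` is stable under the outer conjugation,
# and the pinned character satisfies `r_ψ(σ) · r_ψ(θ_c σ) · χ_cyc(σ) = 1`

Cell `bsd-print-cf2`, width seat `bsd-line-cf2c-w2` g9 (prover-bsd-line-cf2c-w2-g9-0); Theses-free helper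
`--supports stmt-BirchSwinnertonDyer-23295`. THEOREMS ONLY (no `def`, no named fact, no `sorry`); the avatar identity of §3 is CONDITIONAL
(displayed binder) on the print `Deuring_exists_heckeCharacter_of_maximalCM`; nothing about BSD is asserted; no summit statement is proved
by this seat; BSD is not proved by any of this.

WHY (the junction clause of the dictionary, PART 2 PLAN): on `Υ = pairKer κ₁ κ₂` the junction `θ|_Υ = r′|_Υ` reads
`g_ε(υ) = r_ψ(υ) · r_ψ(θ_c υ)` (rows of CM type `(1,0)`), where `r_ψ = e ∘ χ_ψ` is the avatar of the pinned `ψ`, `θ_c` a lift of the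
conjugation by `c`; §3 computes the right-hand side as `χ_cyc(υ)⁻¹`, and -w8 g6's H′ table (`HPrime.cyclotomicCharacter_eq_neg_one_iff_smul_sqrt_neg_one`)
turns that into the sign character of `√−1` (= of `√−2` on `Υ`).

* §0 `exists_unitsChar_eq` — every rank-one framed `r` is `e ∘ χ` for a continuous `χ : Γ_K →ₜ* Aˣ` (`e` the units-to-`GL₁` isomorphism).
* §1 `units_eq_one_or_eq_neg_one_of_mem_pairKer` — `K` imaginary quadratic, any generator pair: a continuous `χ : Γ_K →ₜ* ℤ₂ˣ` takes the
  values `±1` on `Υ` (the `ℤ₂`-valued logarithm `ℓ ∘ χ` dies on `Υ`, `GeneratorPairSupply.apply_eq_one_of_mem_pairKer`).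
* §2 `map_mem_pairKer` — `Υ` is stable under every continuous endomorphism `θ` of `Γ_K` (`κᵢ ∘ θ` die on `Υ` for the same reason).
* §3 ★ `unitsChar_mul_comp_mul_cyclotomic_eq_one` — for the pinned `ψ` of a frame, its avatar `e ∘ χ_ψ`, a lift `θ_c` of the conjugation
  (`res (θ_c σ) = c̃ · res σ · c̃⁻¹`, `c̃ ∉ res Γ_K`) and the cyclotomic units character `χ_cyc`: **`χ_ψ(σ) χ_ψ(θ_c σ) χ_cyc(σ) = 1` for every
  `σ`** — the three characters `e∘χ_ψ`, `(e∘χ_ψ)∘θ_c`, `e∘χ_cyc` are avatars of `ψ`, `ψ∘c`, `‖·‖` (`isPAdicAvatarOf_galConj_comp_of_finrank_eq_two`,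
  `IwasawaTwoVariable.isPAdicAvatarOf_normCharacter`), and at a good Frobenius `ψ(ϖ_w)ψ(ϖ_{cw})·N w⁻¹… = 1` by Deuring (iv) and F2C
  `absNorm_eq_of_frame`; rigidity `AvatarRigidity.eq_of_eventually_entry_eq`.

References: [SerreAbelianLadic1968] Ch. I §1.2, §2.3, Ch. II §2.7; [Washington1997] Thm. 13.4; [SilvermanATAEC1994] Ch. II Thm. 10.5 (b).
-/

set_option autoImplicit false
-- D-0017 layout: summit = sub-problem, so `Summit.BirchSwinnertonDyer.BirchSwinnertonDyer.…` repeats a path component.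
set_option linter.dupNamespace false

noncomputable section

open scoped Classical
open NumberField IsDedekindDomain Field WeierstrassCurve
open Literature Literature.NumberTheory.GaloisRepresentations Literature.NumberTheory.EllipticCurves
open Literature.NumberTheory.EllipticCurves.Rank1Residual
open Summit.BirchSwinnertonDyer.BirchSwinnertonDyer.Theorems.PrintCf2.GoodTwistDictSignAvatar

namespace Summit.BirchSwinnertonDyer.BirchSwinnertonDyer.Theorems.PrintCf2.GoodTwistDictPairSigns

variable {K : Type} [Field K] [NumberField K]

/-! ## §0 Rank-one framed representations are units characters -/

omit [NumberField K] in
/-- Every rank-one framed representation is `e ∘ χ` for a continuous units character `χ` (`e = FramedRep.unitsContinuousMulEquivOfUnique`).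
[folklore] -/
theorem exists_unitsChar_eq {A : Type*} [CommRing A] [TopologicalSpace A] [IsTopologicalRing A] (r : FramedGaloisRep K A 1) :
    ∃ χ : absoluteGaloisGroup K →ₜ* Aˣ,
      r = (FramedRep.unitsContinuousMulEquivOfUnique (Fin 1) A : Aˣ →ₜ* GL (Fin 1) A).comp χ := by
  refine ⟨((FramedRep.unitsContinuousMulEquivOfUnique (Fin 1) A).symm : GL (Fin 1) A →ₜ* Aˣ).comp r, ?_⟩
  ext σ i j
  simp [ContinuousMonoidHom.comp_toFun]

omit [NumberField K] in
/-- The entry of `e ∘ χ` at `σ` is `χ σ`. [folklore] -/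
theorem unitsChar_entry {A : Type*} [CommRing A] [TopologicalSpace A] [IsTopologicalRing A]
    (χ : absoluteGaloisGroup K →ₜ* Aˣ) (σ : absoluteGaloisGroup K) :
    ((((FramedRep.unitsContinuousMulEquivOfUnique (Fin 1) A : Aˣ →ₜ* GL (Fin 1) A).comp χ σ : GL (Fin 1) A) :
      Matrix (Fin 1) (Fin 1) A) 0 0) = (χ σ : A) := by
  change (((FramedRep.unitsContinuousMulEquivOfUnique (Fin 1) A (χ σ) : GL (Fin 1) A) : Matrix (Fin 1) (Fin 1) A) 0 0) = _
  rw [FramedRep.unitsContinuousMulEquivOfUnique_apply_coe]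

/-! ## §1 `ℤ₂ˣ`-valued characters are `±1` on `Υ` -/

/-- **A continuous `χ : Γ_K →ₜ* ℤ₂ˣ` takes the values `±1` on `Υ = pairKer κ₁ κ₂`** (`K` imaginary quadratic, any generator pair): the
`ℤ₂`-valued character `ℓ ∘ χ` (`ker ℓ = μ(ℤ₂) = {±1}`) dies on `Υ` (`GeneratorPairSupply.apply_eq_one_of_mem_pairKer`, rank `2`).
[cite: Washington1997, Thm. 13.4] [cite: SerreAbelianLadic1968, Ch. I §1.2] -/
theorem units_eq_one_or_eq_neg_one_of_mem_pairKer (hK : IsImaginaryQuadratic K) {κ₁ κ₂ : ZpExtension K 2}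
    {γ₁ γ₂ : absoluteGaloisGroup K} (hγ : ZpExtension.IsTopGeneratorPair κ₁ κ₂ γ₁ γ₂) (χ : absoluteGaloisGroup K →ₜ* ℤ_[2]ˣ)
    {σ : absoluteGaloisGroup K} (hσ : σ ∈ ZpExtension.pairKer κ₁ κ₂) : χ σ = 1 ∨ χ σ = -1 := by
  obtain ⟨L, hL⟩ := Literature.NumberTheory.EllipticCurves.PadicInt.exists_continuousMonoidHom_ker_eq_torsion (p := 2)
  have h := GeneratorPairSupply.apply_eq_one_of_mem_pairKer hK.unitsRank_eq_zero hK.nrComplexPlaces_eq_one hγ (L.comp χ) hσ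
  have hmem : χ σ ∈ CommGroup.torsion ℤ_[2]ˣ := by
    rw [← hL, MonoidHom.mem_ker]
    exact h
  exact FineSelmerUpstairs.units_eq_one_or_eq_neg_one_of_mem_torsion_two hmem

/-! ## §2 `Υ` is stable under continuous endomorphisms of `Γ_K` -/

/-- **`θ(Υ) ⊆ Υ` for every continuous endomorphism `θ` of `Γ_K`** (in particular for a lift of the outer conjugation by `Γ_ℚ`): the
`ℤ₂`-valued characters `κᵢ ∘ θ` die on `Υ`. [cite: Washington1997, Thm. 13.4] -/
theorem map_mem_pairKer (hK : IsImaginaryQuadratic K) {κ₁ κ₂ : ZpExtension K 2} {γ₁ γ₂ : absoluteGaloisGroup K}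
    (hγ : ZpExtension.IsTopGeneratorPair κ₁ κ₂ γ₁ γ₂) (θ : absoluteGaloisGroup K →ₜ* absoluteGaloisGroup K)
    {σ : absoluteGaloisGroup K} (hσ : σ ∈ ZpExtension.pairKer κ₁ κ₂) : θ σ ∈ ZpExtension.pairKer κ₁ κ₂ := by
  rw [ZpExtension.mem_pairKer_iff]
  exact ⟨GeneratorPairSupply.apply_eq_one_of_mem_pairKer hK.unitsRank_eq_zero hK.nrComplexPlaces_eq_one hγ
      (κ₁.toContinuousMonoidHom.comp θ) hσ,
    GeneratorPairSupply.apply_eq_one_of_mem_pairKer hK.unitsRank_eq_zero hK.nrComplexPlaces_eq_one hγ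
      (κ₂.toContinuousMonoidHom.comp θ) hσ⟩

/-! ## §3 The pinned character: `χ_ψ(σ) · χ_ψ(θ_c σ) · χ_cyc(σ) = 1` -/

section Frame

variable {d : ℤ} {W : WeierstrassCurve ℚ} [W.IsElliptic] [W.IsGloballyMinimal] {C : VariableChange ℚ}
  {v vbar : HeightOneSpectrum (𝓞 K)} {ψ : HeckeCharacter K}

/-- **`χ_ψ(σ) χ_ψ(θ_c σ) χ_cyc(σ) = 1`.** Frame (`K` imaginary quadratic with `v ≠ v̄` above `2`, `c ≠ 1`, member `W ≅ cm7^{(d)}`, `ψ` of type `(1,0)`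
pinned to `W`), `ι : ℚ̄₂ ≃ ℂ`, `e ∘ χ_ψ` the `2`-adic avatar of `ψ`, `θ_c` a continuous lift of the conjugation by `c̃ ∈ Γ_ℚ ∖ res Γ_K`, and
`χ_cyc` the cyclotomic character read in `ℚ̄₂ˣ`. The framed `e ∘ (χ_ψ · χ_ψ∘θ_c · χ_cyc)` has entry `1` at every Frobenius above a good
prime: `ι⁻¹(ψ(ϖ_w))⁻¹ · ι⁻¹(ψ(ϖ_{cw}))⁻¹ · N w = 1` (Deuring (iv), F2C `absNorm_eq_of_frame`), so it is trivial (rigidity). GRANTED Deuring's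
theorem. [cite: SerreAbelianLadic1968, Ch. I §2.3, Ch. II §2.7] [cite: SilvermanATAEC1994, Ch. II Thm. 10.5 (b)] -/
theorem unitsChar_mul_comp_mul_cyclotomic_eq_one (hDe : Deuring_exists_heckeCharacter_of_maximalCM) (hK : IsImaginaryQuadratic K)
    [IsGalois ℚ K] (hd0 : d ≠ 0) (hCW : C • W = cm7.quadraticTwist (d : ℚ))
    (hv : ((2 : ℕ) : 𝓞 K) ∈ v.asIdeal) (hvbar : ((2 : ℕ) : 𝓞 K) ∈ vbar.asIdeal) (hne : vbar ≠ v)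
    (c : K ≃ₐ[ℚ] K) (hc : c ≠ 1)
    (hψ : ψ.HasInfinityType (fun _ ↦ 1) (fun _ ↦ 0)) (hψL : ∀ s : ℂ, 3 / 2 < s.re → heckeLFunction ψ s = W.LSeries s)
    (ι : PadicAlgCl 2 ≃+* ℂ) {χψ : absoluteGaloisGroup K →ₜ* (PadicAlgCl 2)ˣ}
    (hχψ : IsPAdicAvatarOf ι ψ ((FramedRep.unitsContinuousMulEquivOfUnique (Fin 1) (PadicAlgCl 2) :
      (PadicAlgCl 2)ˣ →ₜ* GL (Fin 1) (PadicAlgCl 2)).comp χψ))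
    {ctil : absoluteGaloisGroup ℚ} (hctil : ctil ∉ Set.range (absGaloisRestrict ℚ K))
    {θc : absoluteGaloisGroup K →ₜ* absoluteGaloisGroup K}
    (hθc : ∀ σ, absGaloisRestrict ℚ K (θc σ) = ctil * absGaloisRestrict ℚ K σ * ctil⁻¹)
    {χcyc : absoluteGaloisGroup K →ₜ* (PadicAlgCl 2)ˣ}
    (hχcyc : ∀ σ : absoluteGaloisGroup K, ((χcyc σ : (PadicAlgCl 2)ˣ) : PadicAlgCl 2) =
      algebraMap ℚ_[2] (PadicAlgCl 2) (((GaloisRep.cyclotomicCharacter K 2 σ : ℤ_[2]ˣ) : ℤ_[2]) : ℚ_[2]))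
    (σ : absoluteGaloisGroup K) :
    ((χψ σ : (PadicAlgCl 2)ˣ) : PadicAlgCl 2) * ((χψ (θc σ) : (PadicAlgCl 2)ˣ) : PadicAlgCl 2) *
      ((χcyc σ : (PadicAlgCl 2)ˣ) : PadicAlgCl 2) = 1 := by
  haveI : Fact (Nat.Prime 2) := ⟨Nat.prime_two⟩
  set e := (FramedRep.unitsContinuousMulEquivOfUnique (Fin 1) (PadicAlgCl 2) : (PadicAlgCl 2)ˣ →ₜ* GL (Fin 1) (PadicAlgCl 2)) with he
  -- the three avatars
  have hc' : IsPAdicAvatarOf ι (HeckeCharacter.galConj c ψ) ((e.comp χψ).comp θc) :=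
    Summit.BirchSwinnertonDyer.Rank1Residual.X11b.Three.LambdaSupply.isPAdicAvatarOf_galConj_comp_of_finrank_eq_two hK.1 ι hχψ hctil hθc hc
  have hN : IsPAdicAvatarOf ι (HeckeCharacter.normCharacter K) (e.comp χcyc) := IwasawaTwoVariable.isPAdicAvatarOf_normCharacter ι hχcyc
  -- the product character and its triviality by rigidity
  set Pch : absoluteGaloisGroup K →ₜ* (PadicAlgCl 2)ˣ := χψ * χψ.comp θc * χcyc with hPch
  have hPchσ : ∀ τ, ((Pch τ : (PadicAlgCl 2)ˣ) : PadicAlgCl 2) =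
      ((χψ τ : (PadicAlgCl 2)ˣ) : PadicAlgCl 2) * ((χψ (θc τ) : (PadicAlgCl 2)ˣ) : PadicAlgCl 2) *
        ((χcyc τ : (PadicAlgCl 2)ˣ) : PadicAlgCl 2) := fun τ ↦ by
    simp only [hPch, ContinuousMonoidHom.mul_apply, ContinuousMonoidHom.comp_toFun, Units.val_mul]
  have hone1 : ∀ τ : absoluteGaloisGroup K, (((1 : absoluteGaloisGroup K →ₜ* (PadicAlgCl 2)ˣ) τ : (PadicAlgCl 2)ˣ) :
      PadicAlgCl 2) = 1 := fun _ ↦ rfl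
  suffices hone : e.comp Pch = e.comp 1 by
    have h := congrArg (fun r : FramedGaloisRep K (PadicAlgCl 2) 1 ↦
      (((r σ : GL (Fin 1) (PadicAlgCl 2)) : Matrix (Fin 1) (Fin 1) (PadicAlgCl 2)) 0 0)) hone
    simp only [he, unitsChar_entry] at h
    rw [← hPchσ, h, hone1]
  refine AvatarRigidity.eq_of_eventually_entry_eq _ _ ?_
  -- Deuring (iv) for the frame and the residue cardinalities
  obtain ⟨-, hiv⟩ := FramePinning.frame_eq_deuring hDe hd0 hCW hK hv hvbar hne c hc hψ hψL
  -- the finite exceptional set: places above `2 Δ(W)`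
  set N : ℤ := 2 * W.minimalDiscriminantInt with hNdef
  have hN0 : N ≠ 0 := mul_ne_zero two_ne_zero (minimalDiscriminantInt_ne_zero W)
  have hfin := IsDedekindDomain.HeightOneSpectrum.finite_setOf_natCast_mem (R := 𝓞 K) (Int.natAbs_ne_zero.mpr hN0)
  refine (hfin.eventually_cofinite_notMem).mono fun w hwN 𝔓 h𝔓 Φ hΦ ↦ ?_
  obtain ⟨p, hp, hpw⟩ := Literature.NumberTheory.EllipticCurves.exists_prime_natCast_mem_asIdeal w
  haveI : Fact p.Prime := ⟨hp⟩
  have hpN : ¬ (p : ℤ) ∣ N := by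
    intro hdvd
    apply hwN
    change ((N.natAbs : ℕ) : 𝓞 K) ∈ w.asIdeal
    obtain ⟨t, ht⟩ := Int.natAbs_dvd_natAbs.mpr hdvd
    rw [ht, Nat.cast_mul]
    exact w.asIdeal.mul_mem_right _ hpw
  have hp2 : p ≠ 2 := by rintro rfl; exact hpN (dvd_mul_right 2 _)
  have hpW : W.HasGoodReductionAtPrime p :=
    WeierstrassCurve.hasGoodReductionAtPrime_of_not_dvd W p fun h ↦ hpN (by rw [hNdef]; exact h.mul_left _)
  have h2w : ((2 : ℕ) : 𝓞 K) ∉ w.asIdeal := by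
    intro h2
    have hcop : Nat.Coprime 2 p := (Nat.coprime_primes Nat.prime_two hp).mpr (Ne.symm hp2)
    obtain ⟨a, b, hab⟩ := Nat.isCoprime_iff_coprime.mpr hcop
    apply w.isPrime.ne_top
    rw [Ideal.eq_top_iff_one]
    have : (1 : 𝓞 K) = (a : 𝓞 K) * ((2 : ℕ) : 𝓞 K) + (b : 𝓞 K) * (p : 𝓞 K) := by exact_mod_cast hab.symm
    rw [this]
    exact w.asIdeal.add_mem (w.asIdeal.mul_mem_left _ h2) (w.asIdeal.mul_mem_left _ hpw)
  obtain ⟨hw, hsp, hin⟩ := hiv p hpW w hpw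
  have hfix : c • (p : 𝓞 K) = (p : 𝓞 K) := map_natCast (MulSemiringAction.toRingHom _ (𝓞 K) c) p
  have hpcw : (p : 𝓞 K) ∈ (c • w).asIdeal := by
    rw [← hfix]
    exact (Literature.NumberTheory.Automorphic.HeightOneSpectrum.smul_mem_smul_asIdeal_iff c w _).mpr hpw
  obtain ⟨hcw, -, -⟩ := hiv p hpW (c • w) hpcw
  have hcunr : (HeckeCharacter.galConj c ψ).IsUnramifiedAt w := (HeckeCharacter.isUnramifiedAt_galConj_iff c ψ w).mpr hcw
  -- the three Frobenius entries
  have e1 := AvatarRigidity.entry_eq_of_isPAdicAvatarOf ι hχψ h2w hw 𝔓 h𝔓 Φ hΦ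
  have e2 := AvatarRigidity.entry_eq_of_isPAdicAvatarOf ι hc' h2w hcunr 𝔓 h𝔓 Φ hΦ
  have e3 := AvatarRigidity.entry_eq_of_isPAdicAvatarOf ι hN h2w (HeckeCharacter.isUnramifiedAt_normCharacter' w) 𝔓 h𝔓 Φ hΦ
  rw [he, unitsChar_entry] at e1 e3
  rw [ContinuousMonoidHom.comp_toFun, he, unitsChar_entry, HeckeCharacter.valueAtUniformizer_galConj_of_isUnramifiedAt c ψ w hcw] at e2
  -- `ψ(ϖ_w) ψ(ϖ_{cw}) = N w ≠ 0`
  have hNw := absNorm_eq_of_frame hDe hK hd0 hCW hv hvbar hne c hc hψ hψL hpW hpw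
  have hprod : ψ.valueAtUniformizer w * ψ.valueAtUniformizer (c • w) = (w.residueCard : ℂ) := by
    rw [HeightOneSpectrum.residueCard, hNw]
    by_cases hcw' : c • w = w
    · rw [if_pos hcw', hcw', (hin hcw').2]; push_cast; ring
    · rw [if_neg hcw']; exact (hsp hcw').2
  have hres0 : (w.residueCard : ℂ) ≠ 0 := by
    rw [HeightOneSpectrum.residueCard]
    exact_mod_cast (Ideal.absNorm_eq_zero_iff.not.mpr w.ne_bot)
  rw [he, unitsChar_entry, unitsChar_entry, hPchσ, e1, e2, e3, HeckeCharacter.valueAtUniformizer_normCharacter, hone1,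
    ← mul_inv, ← map_mul, hprod, map_inv₀, inv_inv, inv_mul_cancel₀]
  exact (map_ne_zero ι.symm).mpr hres0

end Frame

end Summit.BirchSwinnertonDyer.BirchSwinnertonDyer.Theorems.PrintCf2.GoodTwistDictPairSigns

end
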